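import Summits.QuantumFields.QCD.Theses.HeatSlicedQuarks
import Summits.QuantumFields.QCD.Theorems.HeatSlicedQuarksInterleavedHeatSliceFlowStubColumnIdentification
import Summits.QuantumFields.QCD.Theorems.HeatSlicedQuarksSmallFieldUltracontractivityStubDiagonalMonotone
import Summits.QuantumFields.QCD.Theorems.HeatSlicedQuarksInterleavedHeatSliceFlowStubInteriorAssembly

/-!
# Stub `stub_derivativeColumnIdentification` of line `Sketch` — analytic helpers
(crux `TracedQuadraticParametrix`, item stmt-QuantumFields-17985; lead prover-line-stmt-QuantumFields-17985-0)

General `ℓ²` tools for the DERIVATIVE column law `‖D_W (K_W(s) − K_1(s)) e_x‖₂ ≤ C δ/√(1+s)`: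

* `deriv_smoothing` — `‖D e^{-σDᴴD} v‖₂ ≤ (9√2/√(1+162eσ)) ‖v‖₂` for the `r = 1` Wilson–Dirac matrix (the mirror image of
  the landed `combined_smoothing`, which treats `e^{-σDᴴD} Dᴴ`);
* `deriv_adjoint_smoothing` — `‖D e^{-σDᴴD} Dᴴ v‖₂ ≤ (162/(1 + 81eσ)) ‖v‖₂` (both Dirac factors on one kernel: the product
  of the two profiles at `σ/2`);
* `sum_norm_sq_col_mul_exp_le` — the spectral `ℓ¹ → ℓ²` gain of one derivative: for ANY square matrix `A` and `σ > 0`,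
  `Σ_i ‖(A e^{-σAᴴA})(i,q)‖² ≤ (eσ)⁻¹ · Re e^{-σAᴴA}(q,q)` (`= Re (AᴴA e^{-2σAᴴA})(q,q) = Σ_k |U_{qk}|² λ_k e^{-2σλ_k}` and
  `λ e^{-σλ} ≤ 1/(eσ)`), which the closed crux 8871 turns into `≤ C₈₈₇₁/(e σ³)` at every site.
-/

noncomputable section

namespace Summit.QuantumFields.QCD.Cruxes.TracedQuadraticParametrix.Sketch

open Literature.MathematicalPhysics.QuantumLattice Literature.MathematicalPhysics.QuantumFieldTheory
  Literature.Probability.LatticeModels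
open Summit.QuantumFields.QCD.Theses.HeatSlicedQuarks
open Summit.QuantumFields.QCD.Cruxes.InterleavedHeatSliceFlow.Sketch
open Summit.QuantumFields.QCD.Theorems.SmallFieldUltracontractivity.Negative
open Summit.QuantumFields.QCD.Cruxes.SmallFieldUltracontractivity.PointCentredAxialParabolic
open MeasureTheory intervalIntegral
open scoped Matrix ComplexConjugate

variable {L : ℕ} [NeZero L]

/-! ### `ℓ²` bounds for the Wilson–Dirac matrix and its heat semigroup -/

/-- `‖D_W u‖₂² ≤ 81 ‖u‖₂²` for the `r = 1` Wilson–Dirac matrix at any gauge field and any mass `m ∈ [-1/2, 1]`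
(HJL (2.14): `‖D_W‖ ≤ |m+4| + 4 ≤ 9`). -/
theorem sum_norm_sq_wilsonDirac_mulVec_le_81
    (U : GaugeConfig 4 L (Matrix.specialUnitaryGroup (Fin 3) ℂ)) {m : ℝ} (hm : m ∈ Set.Icc (-(1 / 2 : ℝ)) 1)
    (u : TorusSite 4 L × Fin 3 × Fin 4 → ℂ) :
    ∑ i, ‖((wilsonDirac (fundamentalRep (Fin 3)) U m 1).mulVec u) i‖ ^ 2 ≤ 81 * ∑ i, ‖u i‖ ^ 2 := by
  open scoped Matrix.Norms.L2Operator in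
  have h1 := sum_norm_sq_mulVec_le (wilsonDirac (fundamentalRep (Fin 3)) U m 1) u
  open scoped Matrix.Norms.L2Operator in
  have h2 : ‖wilsonDirac (fundamentalRep (Fin 3)) U m 1‖ ≤ 9 := by
    refine (l2_opNorm_wilsonDirac_le (fundamentalRep (Fin 3)) fundamentalRep_mem_unitaryGroup U m).trans ?_
    have hm4 : |m + 4| ≤ 5 := by rw [abs_le]; constructor <;> linarith [hm.1, hm.2]
    linarith
  open scoped Matrix.Norms.L2Operator in
  have h3 : ‖wilsonDirac (fundamentalRep (Fin 3)) U m 1‖ ^ 2 ≤ 81 := by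
    nlinarith [norm_nonneg (wilsonDirac (fundamentalRep (Fin 3)) U m 1)]
  have h0 : 0 ≤ ∑ i, ‖u i‖ ^ 2 := Finset.sum_nonneg fun i _ => by positivity
  exact h1.trans (mul_le_mul_of_nonneg_right h3 h0)

/-- **Derivative smoothing** `‖D e^{-σDᴴD} u‖₂ ≤ (9√2/√(1 + 162eσ)) ‖u‖₂` for all `σ ≥ 0`: for `162eσ ≤ 1` the contraction
followed by `‖D‖ ≤ 9`, for `162eσ ≥ 1` the landed parabolic smoothing `stub_freeSmoothing` (`(2eσ)^{-1/2}`). -/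
theorem deriv_smoothing (U : GaugeConfig 4 L (Matrix.specialUnitaryGroup (Fin 3) ℂ)) {m : ℝ}
    (hm : m ∈ Set.Icc (-(1 / 2 : ℝ)) 1) {σ : ℝ} (hσ : 0 ≤ σ) (u : TorusSite 4 L × Fin 3 × Fin 4 → ℂ) :
    Real.sqrt (∑ i, ‖((wilsonDirac (fundamentalRep (Fin 3)) U m 1 *
        NormedSpace.exp (-(σ : ℂ) • ((wilsonDirac (fundamentalRep (Fin 3)) U m 1)ᴴ *
          wilsonDirac (fundamentalRep (Fin 3)) U m 1))).mulVec u) i‖ ^ 2) ≤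
      9 * Real.sqrt 2 / Real.sqrt (1 + 162 * Real.exp 1 * σ) * Real.sqrt (∑ i, ‖u i‖ ^ 2) := by
  set D := wilsonDirac (fundamentalRep (Fin 3)) U m 1 with hD
  have hu0 : 0 ≤ ∑ i, ‖u i‖ ^ 2 := Finset.sum_nonneg fun i _ => by positivity
  by_cases hcase : 162 * Real.exp 1 * σ ≤ 1
  · have h1 : ∑ i, ‖((D * NormedSpace.exp (-(σ : ℂ) • (Dᴴ * D))).mulVec u) i‖ ^ 2 ≤ 81 * ∑ i, ‖u i‖ ^ 2 := by
      rw [← Matrix.mulVec_mulVec]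
      refine (sum_norm_sq_wilsonDirac_mulVec_le_81 U hm _).trans ?_
      exact mul_le_mul_of_nonneg_left (heat_mulVec_contraction D hσ u) (by norm_num)
    calc Real.sqrt (∑ i, ‖((D * NormedSpace.exp (-(σ : ℂ) • (Dᴴ * D))).mulVec u) i‖ ^ 2)
        ≤ Real.sqrt (81 * ∑ i, ‖u i‖ ^ 2) := Real.sqrt_le_sqrt h1
      _ = 9 * Real.sqrt (∑ i, ‖u i‖ ^ 2) := by
          rw [Real.sqrt_mul (by norm_num), show (81 : ℝ) = 9 ^ 2 by norm_num, Real.sqrt_sq (by norm_num)]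
      _ ≤ 9 * Real.sqrt 2 / Real.sqrt (1 + 162 * Real.exp 1 * σ) * Real.sqrt (∑ i, ‖u i‖ ^ 2) :=
          mul_le_mul_of_nonneg_right (nine_le_profile hσ hcase) (Real.sqrt_nonneg _)
  · push Not at hcase
    have hσ0 : 0 < σ := by
      by_contra hneg; push Not at hneg
      have : σ = 0 := le_antisymm hneg hσ
      rw [this, mul_zero] at hcase; linarith
    have h1 := stub_freeSmoothing _ D σ hσ0 u
    have hA : 0 < 2 * Real.exp 1 * σ := by positivity
    calc Real.sqrt (∑ i, ‖((D * NormedSpace.exp (-(σ : ℂ) • (Dᴴ * D))).mulVec u) i‖ ^ 2)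
        ≤ Real.sqrt ((2 * Real.exp 1 * σ)⁻¹ * ∑ i, ‖u i‖ ^ 2) := Real.sqrt_le_sqrt h1
      _ = (Real.sqrt (2 * Real.exp 1 * σ))⁻¹ * Real.sqrt (∑ i, ‖u i‖ ^ 2) := by
          rw [Real.sqrt_mul (inv_nonneg.mpr hA.le), Real.sqrt_inv]
      _ ≤ 9 * Real.sqrt 2 / Real.sqrt (1 + 162 * Real.exp 1 * σ) * Real.sqrt (∑ i, ‖u i‖ ^ 2) :=
          mul_le_mul_of_nonneg_right (inv_sqrt_le_profile hcase.le) (Real.sqrt_nonneg _)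

/-- The square of the merged smoothing profile at half time: `(9√2/√(1+162e(σ/2)))² = 162/(1+81eσ)`. -/
theorem profile_half_sq (σ : ℝ) (hσ : 0 ≤ σ) :
    (9 * Real.sqrt 2 / Real.sqrt (1 + 162 * Real.exp 1 * (σ / 2))) *
        (9 * Real.sqrt 2 / Real.sqrt (1 + 162 * Real.exp 1 * (σ / 2))) = 162 / (1 + 81 * Real.exp 1 * σ) := by
  have hpos : 0 < 1 + 162 * Real.exp 1 * (σ / 2) := by positivity
  rw [div_mul_div_comm, Real.mul_self_sqrt hpos.le, mul_mul_mul_comm, Real.mul_self_sqrt (by norm_num)]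
  congr 1 <;> ring

/-- **Two Dirac factors on one kernel**: `‖D e^{-σDᴴD} Dᴴ v‖₂ ≤ (162/(1 + 81eσ)) ‖v‖₂` for `σ ≥ 0` — split the kernel at
`σ/2` and use `deriv_smoothing` and the landed `combined_smoothing` at `σ/2` each. -/
theorem deriv_adjoint_smoothing (U : GaugeConfig 4 L (Matrix.specialUnitaryGroup (Fin 3) ℂ)) {m : ℝ}
    (hm : m ∈ Set.Icc (-(1 / 2 : ℝ)) 1) {σ : ℝ} (hσ : 0 ≤ σ) (v : TorusSite 4 L × Fin 3 × Fin 4 → ℂ) :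
    Real.sqrt (∑ i, ‖((wilsonDirac (fundamentalRep (Fin 3)) U m 1 *
        NormedSpace.exp (-(σ : ℂ) • ((wilsonDirac (fundamentalRep (Fin 3)) U m 1)ᴴ *
          wilsonDirac (fundamentalRep (Fin 3)) U m 1)) *
        (wilsonDirac (fundamentalRep (Fin 3)) U m 1)ᴴ).mulVec v) i‖ ^ 2) ≤
      162 / (1 + 81 * Real.exp 1 * σ) * Real.sqrt (∑ i, ‖v i‖ ^ 2) := by
  set D := wilsonDirac (fundamentalRep (Fin 3)) U m 1 with hD
  have hσ2 : 0 ≤ σ / 2 := by linarith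
  have hsplit : D * NormedSpace.exp (-(σ : ℂ) • (Dᴴ * D)) * Dᴴ =
      (D * NormedSpace.exp (-((σ / 2 : ℝ) : ℂ) • (Dᴴ * D))) *
        (NormedSpace.exp (-((σ / 2 : ℝ) : ℂ) • (Dᴴ * D)) * Dᴴ) := by
    rw [exp_neg_smul_eq_sq (Dᴴ * D) σ]
    simp only [Matrix.mul_assoc]
  rw [hsplit, ← Matrix.mulVec_mulVec]
  refine (deriv_smoothing U hm hσ2 _).trans ?_
  have h2 := combined_smoothing U hm hσ2 v
  have hφ0 : 0 ≤ 9 * Real.sqrt 2 / Real.sqrt (1 + 162 * Real.exp 1 * (σ / 2)) := by positivity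
  calc 9 * Real.sqrt 2 / Real.sqrt (1 + 162 * Real.exp 1 * (σ / 2)) *
        Real.sqrt (∑ i, ‖((NormedSpace.exp (-((σ / 2 : ℝ) : ℂ) • (Dᴴ * D)) * Dᴴ).mulVec v) i‖ ^ 2)
      ≤ 9 * Real.sqrt 2 / Real.sqrt (1 + 162 * Real.exp 1 * (σ / 2)) *
          (9 * Real.sqrt 2 / Real.sqrt (1 + 162 * Real.exp 1 * (σ / 2)) * Real.sqrt (∑ i, ‖v i‖ ^ 2)) :=
        mul_le_mul_of_nonneg_left h2 hφ0
    _ = 162 / (1 + 81 * Real.exp 1 * σ) * Real.sqrt (∑ i, ‖v i‖ ^ 2) := by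
        rw [← mul_assoc, profile_half_sq σ hσ]

/-! ### The spectral `ℓ¹ → ℓ²` gain of one derivative -/

/-- Column sums of squares are diagonal entries of `MᴴM`: `Σ_i ‖M i q‖² = Re (MᴴM)(q,q)`. -/
theorem sum_norm_sq_col_eq_re_conjTranspose_mul_self {ι : Type} [Fintype ι] (M : Matrix ι ι ℂ) (q : ι) :
    ∑ i, ‖M i q‖ ^ 2 = ((Mᴴ * M) q q).re := by
  rw [Matrix.mul_apply, Complex.re_sum]
  refine Finset.sum_congr rfl fun i _ => ?_
  rw [Matrix.conjTranspose_apply, Complex.star_def, Complex.conj_mul', ← Complex.ofReal_pow, Complex.ofReal_re]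

/-- **One derivative, `ℓ¹ → ℓ²`, spectral form.**  For every square complex matrix `A`, `σ > 0` and index `q`:
`Σ_i ‖(A e^{-σAᴴA})(i,q)‖² ≤ (eσ)⁻¹ · Re e^{-σAᴴA}(q,q)`.  Indeed the left side is `Re (AᴴA e^{-2σAᴴA})(q,q) =
Σ_k |U_{qk}|² λ_k e^{-2σλ_k}` in the eigenbasis of `AᴴA` (`re_mul_exp_apply_self`), and `λ e^{-2σλ} ≤ (eσ)⁻¹ e^{-σλ}`
(`mul_exp_neg_mul_le`), while `Σ_k |U_{qk}|² e^{-σλ_k} = Re e^{-σAᴴA}(q,q)` (`re_exp_neg_smul_apply_self_eq_sum`). -/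
theorem sum_norm_sq_col_mul_exp_le {ι : Type} [Fintype ι] [DecidableEq ι] (A : Matrix ι ι ℂ) {σ : ℝ}
    (hσ : 0 < σ) (q : ι) :
    ∑ i, ‖(A * NormedSpace.exp (-(σ : ℂ) • (Aᴴ * A))) i q‖ ^ 2 ≤
      (Real.exp 1 * σ)⁻¹ * ((NormedSpace.exp (-(σ : ℂ) • (Aᴴ * A))) q q).re := by
  have hH : (Aᴴ * A).IsHermitian := Matrix.isHermitian_conjTranspose_mul_self A
  set K : Matrix ι ι ℂ := NormedSpace.exp (-(σ : ℂ) • (Aᴴ * A)) with hK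
  have hKherm : K.IsHermitian := isHermitian_exp_neg_smul A σ
  -- `(A K)ᴴ (A K) = K (AᴴA) K = (AᴴA) K(2σ)`
  have hcomm : K * (Aᴴ * A) = (Aᴴ * A) * K := by
    rw [hK]
    refine (exp_mul_eq_mul_exp_of_comm (-(σ : ℂ) • (Aᴴ * A)) (-(σ : ℂ) • (Aᴴ * A)) (Aᴴ * A) ?_)
    rw [Matrix.smul_mul, Matrix.mul_smul]
  have hsq : K * K = NormedSpace.exp (-((2 * σ : ℝ) : ℂ) • (Aᴴ * A)) := by
    rw [exp_neg_smul_eq_sq (Aᴴ * A) (2 * σ), show (2 * σ / 2 : ℝ) = σ by ring]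
  have hprod : (A * K)ᴴ * (A * K) = Aᴴ * A * NormedSpace.exp (-((2 * σ : ℝ) : ℂ) • (Aᴴ * A)) := by
    rw [Matrix.conjTranspose_mul, hKherm.eq, Matrix.mul_assoc, ← Matrix.mul_assoc Aᴴ, ← Matrix.mul_assoc,
      hcomm, Matrix.mul_assoc, hsq]
  rw [sum_norm_sq_col_eq_re_conjTranspose_mul_self, hprod, HeatRowCalculus.re_mul_exp_apply_self A hH (2 * σ) q,
    hK, re_exp_neg_smul_apply_self_eq_sum A hH σ q, Finset.mul_sum]
  refine Finset.sum_le_sum fun k _ => ?_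
  have hU : 0 ≤ ‖(hH.eigenvectorUnitary : Matrix ι ι ℂ) q k‖ ^ 2 := sq_nonneg _
  have key : hH.eigenvalues k * Real.exp (-(2 * σ * hH.eigenvalues k)) ≤
      (Real.exp 1 * σ)⁻¹ * Real.exp (-(σ * hH.eigenvalues k)) := by
    have h1 := HeatRowCalculus.mul_exp_neg_mul_le (hH.eigenvalues k) hσ
    have hsplit : Real.exp (-(2 * σ * hH.eigenvalues k)) =
        Real.exp (-(σ * hH.eigenvalues k)) * Real.exp (-(σ * hH.eigenvalues k)) := by
      rw [← Real.exp_add]; congr 1; ring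
    rw [hsplit, ← mul_assoc, one_div] at *
    exact mul_le_mul_of_nonneg_right h1 (Real.exp_pos _).le
  calc ‖(hH.eigenvectorUnitary : Matrix ι ι ℂ) q k‖ ^ 2 * (hH.eigenvalues k * Real.exp (-(2 * σ * hH.eigenvalues k)))
      ≤ ‖(hH.eigenvectorUnitary : Matrix ι ι ℂ) q k‖ ^ 2 * ((Real.exp 1 * σ)⁻¹ * Real.exp (-(σ * hH.eigenvalues k))) :=
        mul_le_mul_of_nonneg_left key hU
    _ = (Real.exp 1 * σ)⁻¹ * (‖(hH.eigenvectorUnitary : Matrix ι ι ℂ) q k‖ ^ 2 * Real.exp (-(σ * hH.eigenvalues k))) := by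
        ring

/-! ### Minkowski bookkeeping with the parabolic decay `1/√(1+s)` -/

/-- `1/√(1 + s/2) ≤ √2/√(1+s)` for `s ≥ 0` (indeed `2(1 + s/2) = 2 + s ≥ 1 + s`). -/
theorem inv_sqrt_one_add_half_le {s : ℝ} (hs : 0 ≤ s) :
    1 / Real.sqrt (1 + s / 2) ≤ Real.sqrt 2 / Real.sqrt (1 + s) := by
  have h1 : 0 < Real.sqrt (1 + s / 2) := Real.sqrt_pos.mpr (by linarith)
  have h2 : 0 < Real.sqrt (1 + s) := Real.sqrt_pos.mpr (by linarith)
  rw [div_le_div_iff₀ h1 h2, one_mul, ← Real.sqrt_mul (by norm_num)]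
  exact Real.sqrt_le_sqrt (by linarith)

/-- **Second vertex** (one Dirac factor on the interacting kernel).  If `v_q = ∫₀ˢ F(τ)_q dτ` with `F(·)_q` continuous,
`‖F(τ)‖₂ ≤ φ(s−τ)·P/(1+τ)` on `[0,s]` (merged smoothing profile `φ(σ) = 9√2/√(1+162eσ)`), and, when `s ≥ 2`,
`‖F(τ)‖₂ ≤ Q/(s√s)` on `[0,s/2]`, then `‖v‖₂ ≤ (80P + Q)/√(1+s)`.  (Small `s`: constant majorant; `s ≥ 2`: the early half
is `Q/(2√s)`, the late half `≤ 2P/√(1+s/2)` by `late_smoothing_const_le`.) -/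
theorem second_vertex_norm_le {ι : Type} [Fintype ι] (v : ι → ℂ) (F : ℝ → ι → ℂ) {s P Q : ℝ}
    (hs0 : 0 ≤ s) (hP : 0 ≤ P) (hQ : 0 ≤ Q)
    (hduh : ∀ q, v q = ∫ τ in (0:ℝ)..s, F τ q)
    (hFcont : ∀ q, ContinuousOn (fun τ => F τ q) (Set.Icc 0 s))
    (hpt1 : ∀ τ, 0 ≤ τ → τ ≤ s → Real.sqrt (∑ q, ‖F τ q‖ ^ 2) ≤
      9 * Real.sqrt 2 / Real.sqrt (1 + 162 * Real.exp 1 * (s - τ)) * (P / (1 + τ)))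
    (hpt2 : 2 ≤ s → ∀ τ, 0 ≤ τ → τ ≤ s / 2 → Real.sqrt (∑ q, ‖F τ q‖ ^ 2) ≤ Q / (s * Real.sqrt s)) :
    Real.sqrt (∑ q, ‖v q‖ ^ 2) ≤ (80 * P + Q) / Real.sqrt (1 + s) := by
  have hFint : ∀ q (a' b' : ℝ), 0 ≤ a' → a' ≤ b' → b' ≤ s → IntervalIntegrable (fun τ => F τ q) volume a' b' := by
    intro q a' b' ha hab hb
    exact ((hFcont q).mono (Set.uIcc_subset_Icc ⟨ha, hab.trans hb⟩ ⟨ha.trans hab, hb⟩)).intervalIntegrable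
  have hφle : ∀ σ, 0 ≤ σ → 9 * Real.sqrt 2 / Real.sqrt (1 + 162 * Real.exp 1 * σ) ≤ 9 * Real.sqrt 2 := fun σ hσ => by
    refine div_le_self (by positivity) ?_
    exact Real.one_le_sqrt.mpr (by nlinarith [Real.exp_pos 1])
  have hs1 : 0 < Real.sqrt (1 + s) := Real.sqrt_pos.mpr (by linarith)
  have hsqrt2 : Real.sqrt 2 ≤ 2 := by
    rw [show (2:ℝ) = Real.sqrt 4 by rw [show (4:ℝ) = 2 ^ 2 by norm_num, Real.sqrt_sq (by norm_num)]]
    exact Real.sqrt_le_sqrt (by norm_num)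
  by_cases hs2 : s < 2
  · -- small times: one interval, constant dominating function
    set G : ℝ → ℝ := fun _ => 9 * Real.sqrt 2 * P with hG
    have hbound : ∀ τ ∈ Set.Icc (0:ℝ) s, Real.sqrt (∑ q, ‖F τ q‖ ^ 2) ≤ G τ := by
      intro τ hτ
      refine (hpt1 τ hτ.1 hτ.2).trans ?_
      have h1 : P / (1 + τ) ≤ P := div_le_self hP (by linarith [hτ.1])
      exact mul_le_mul (hφle _ (by linarith [hτ.2])) h1 (div_nonneg hP (by linarith [hτ.1])) (by positivity)
    have hdual := sqrt_sum_norm_sq_le_integral_of_forall_le v F G hs0 hFcont continuousOn_const hduh hbound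
    refine hdual.trans ?_
    rw [intervalIntegral.integral_const, smul_eq_mul, sub_zero, le_div_iff₀ hs1]
    have hsq3 : Real.sqrt (1 + s) ≤ 2 := by
      rw [show (2:ℝ) = Real.sqrt 4 by rw [show (4:ℝ) = 2 ^ 2 by norm_num, Real.sqrt_sq (by norm_num)]]
      exact Real.sqrt_le_sqrt (by linarith)
    calc s * (9 * Real.sqrt 2 * P) * Real.sqrt (1 + s) ≤ 2 * (9 * 2 * P) * 2 := by
          gcongr
      _ ≤ 80 * P + Q := by nlinarith
  · -- large times: split at `s/2`
    push Not at hs2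
    have hs4 : 0 ≤ s / 2 := by linarith
    have hsplit : ∀ q, v q = (∫ τ in (0:ℝ)..(s / 2), F τ q) + ∫ τ in (s / 2)..s, F τ q := fun q => by
      rw [hduh q, intervalIntegral.integral_add_adjacent_intervals (hFint q 0 (s / 2) le_rfl hs4 (by linarith))
        (hFint q (s / 2) s hs4 (by linarith) le_rfl)]
    have hss : 0 < Real.sqrt s := Real.sqrt_pos.mpr (by linarith)
    -- early half: constant majorant `Q/(s√s)`
    have hdual_e := sqrt_sum_norm_sq_le_integral_of_forall_le (fun q => ∫ τ in (0:ℝ)..(s / 2), F τ q) F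
      (fun _ => Q / (s * Real.sqrt s)) hs4 (fun q => (hFcont q).mono (Set.Icc_subset_Icc le_rfl (by linarith)))
      continuousOn_const (fun q => rfl) (fun τ hτ => hpt2 hs2 τ hτ.1 hτ.2)
    have hint_e : (∫ _τ in (0:ℝ)..(s / 2), Q / (s * Real.sqrt s)) ≤ Q / Real.sqrt (1 + s) := by
      rw [intervalIntegral.integral_const, smul_eq_mul, sub_zero]
      have h1 : s / 2 * (Q / (s * Real.sqrt s)) = Q / (2 * Real.sqrt s) := by
        field_simp
      rw [h1]
      refine div_le_div_of_nonneg_left hQ hs1 ?_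
      -- `√(1+s) ≤ 2√s` for `s ≥ 2`
      rw [show 2 * Real.sqrt s = Real.sqrt (4 * s) by
        rw [Real.sqrt_mul (by norm_num), show (4:ℝ) = 2 ^ 2 by norm_num, Real.sqrt_sq (by norm_num)]]
      exact Real.sqrt_le_sqrt (by linarith)
    -- late half
    set Gl : ℝ → ℝ := fun τ => P / (1 + s / 2) * (9 * Real.sqrt 2) *
        (1 / Real.sqrt (1 + 162 * Real.exp 1 * (s - τ))) with hGl
    have hGl_cont : ContinuousOn Gl (Set.Icc (s / 2) s) := by
      rw [hGl]
      refine ContinuousOn.mul continuousOn_const ?_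
      refine ContinuousOn.div continuousOn_const (by fun_prop) fun τ hτ => ?_
      exact (Real.sqrt_pos.mpr (by nlinarith [hτ.2, Real.exp_pos 1])).ne'
    have hbound_l : ∀ τ ∈ Set.Icc (s / 2) s, Real.sqrt (∑ q, ‖F τ q‖ ^ 2) ≤ Gl τ := by
      intro τ hτ
      have hτ0 : 0 ≤ τ := by linarith [hτ.1]
      refine (hpt1 τ hτ0 hτ.2).trans ?_
      rw [hGl]
      have h1 : P / (1 + τ) ≤ P / (1 + s / 2) := div_le_div_of_nonneg_left hP (by linarith) (by linarith [hτ.1])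
      have h2 : 0 ≤ 9 * Real.sqrt 2 / Real.sqrt (1 + 162 * Real.exp 1 * (s - τ)) := by positivity
      calc 9 * Real.sqrt 2 / Real.sqrt (1 + 162 * Real.exp 1 * (s - τ)) * (P / (1 + τ))
          ≤ 9 * Real.sqrt 2 / Real.sqrt (1 + 162 * Real.exp 1 * (s - τ)) * (P / (1 + s / 2)) :=
            mul_le_mul_of_nonneg_left h1 h2
        _ = _ := by ring
    have hdual_l := sqrt_sum_norm_sq_le_integral_of_forall_le (fun q => ∫ τ in (s / 2)..s, F τ q) F Gl
      (by linarith : s / 2 ≤ s) (fun q => (hFcont q).mono (Set.Icc_subset_Icc hs4 le_rfl)) hGl_cont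
      (fun q => rfl) hbound_l
    have hint_l : (∫ τ in (s / 2)..s, Gl τ) ≤ 2 * P / Real.sqrt (1 + s / 2) := by
      rw [hGl, intervalIntegral.integral_const_mul]
      have hsub : (∫ τ in (s / 2)..s, 1 / Real.sqrt (1 + 162 * Real.exp 1 * (s - τ))) =
          ∫ u in (0:ℝ)..(s / 2), 1 / Real.sqrt (1 + 162 * Real.exp 1 * u) := by
        rw [intervalIntegral.integral_comp_sub_left (fun u => 1 / Real.sqrt (1 + 162 * Real.exp 1 * u)) s]
        congr 1 <;> ring
      rw [hsub]
      have hI := integral_inv_sqrt_one_add_mul_le (k := 162 * Real.exp 1) (by positivity) hs4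
      have hA : 0 < 1 + s / 2 := by linarith
      have hsq : Real.sqrt (1 + s / 2) * Real.sqrt (1 + s / 2) = 1 + s / 2 := Real.mul_self_sqrt hA.le
      have hsq0 : 0 < Real.sqrt (1 + s / 2) := Real.sqrt_pos.mpr hA
      calc P / (1 + s / 2) * (9 * Real.sqrt 2) * ∫ u in (0:ℝ)..(s / 2), 1 / Real.sqrt (1 + 162 * Real.exp 1 * u)
          ≤ P / (1 + s / 2) * (9 * Real.sqrt 2) *
              (2 * Real.sqrt (1 + 162 * Real.exp 1 * (s / 2)) / (162 * Real.exp 1)) :=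
            mul_le_mul_of_nonneg_left hI (by positivity)
        _ = (9 * Real.sqrt 2 / Real.sqrt (1 + s / 2) *
              (2 * Real.sqrt (1 + 162 * Real.exp 1 * (s / 2)) / (162 * Real.exp 1))) * (P / Real.sqrt (1 + s / 2)) := by
            have hkey : P / (1 + s / 2) = P / Real.sqrt (1 + s / 2) / Real.sqrt (1 + s / 2) := by
              rw [div_div, hsq]
            rw [hkey]
            ring
        _ ≤ 2 * (P / Real.sqrt (1 + s / 2)) :=
            mul_le_mul_of_nonneg_right (late_smoothing_const_le hs0) (by positivity)
        _ = 2 * P / Real.sqrt (1 + s / 2) := by ring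
    have hint_l' : 2 * P / Real.sqrt (1 + s / 2) ≤ 2 * Real.sqrt 2 * P / Real.sqrt (1 + s) := by
      have h := inv_sqrt_one_add_half_le hs0
      have hP2 : 0 ≤ 2 * P := by positivity
      calc 2 * P / Real.sqrt (1 + s / 2) = 2 * P * (1 / Real.sqrt (1 + s / 2)) := by ring
        _ ≤ 2 * P * (Real.sqrt 2 / Real.sqrt (1 + s)) := mul_le_mul_of_nonneg_left h hP2
        _ = 2 * Real.sqrt 2 * P / Real.sqrt (1 + s) := by ring
    -- combine
    have hsum : Real.sqrt (∑ q, ‖v q‖ ^ 2) ≤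
        Real.sqrt (∑ q, ‖∫ τ in (0:ℝ)..(s / 2), F τ q‖ ^ 2) + Real.sqrt (∑ q, ‖∫ τ in (s / 2)..s, F τ q‖ ^ 2) := by
      simp only [hsplit]
      exact sqrt_sum_norm_sq_add_le _ _
    refine hsum.trans ((add_le_add (hdual_e.trans hint_e) (hdual_l.trans (hint_l.trans hint_l'))).trans ?_)
    rw [← add_div, div_le_div_iff_of_pos_right hs1]
    nlinarith [hsqrt2, hP, hQ, Real.sqrt_nonneg 2]

/-- **First vertex, early half** (two Dirac factors on the interacting kernel, `‖DK(s−τ)Dᴴ‖ ≤ 162/(1+81e(s−τ))`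
against `P/√(1+τ)` on `[0, s/2]`): `‖∫₀^{s/2} F‖₂ ≤ 324 P/√(1+s)` — the factor `1/(1 + 81e s/2) ≤ 1/(1+s)` pays for
`∫₀^{s/2} dτ/√(1+τ) ≤ 2√(1+s/2)`. -/
theorem first_vertex_early_norm_le {ι : Type} [Fintype ι] (v : ι → ℂ) (F : ℝ → ι → ℂ) {s P : ℝ}
    (hs0 : 0 ≤ s) (hP : 0 ≤ P)
    (hduh : ∀ q, v q = ∫ τ in (0:ℝ)..(s / 2), F τ q)
    (hFcont : ∀ q, ContinuousOn (fun τ => F τ q) (Set.Icc 0 (s / 2)))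
    (hpt : ∀ τ, 0 ≤ τ → τ ≤ s / 2 → Real.sqrt (∑ q, ‖F τ q‖ ^ 2) ≤
      162 / (1 + 81 * Real.exp 1 * (s - τ)) * (P / Real.sqrt (1 + τ))) :
    Real.sqrt (∑ q, ‖v q‖ ^ 2) ≤ 324 * P / Real.sqrt (1 + s) := by
  have hs4 : 0 ≤ s / 2 := by linarith
  have he1 : 1 ≤ Real.exp 1 := Real.one_le_exp one_pos.le
  have hs1 : 0 < Real.sqrt (1 + s) := Real.sqrt_pos.mpr (by linarith)
  set Ge : ℝ → ℝ := fun τ => 162 / (1 + s) * P * (1 / Real.sqrt (1 + τ)) with hGe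
  have hGe_cont : ContinuousOn Ge (Set.Icc 0 (s / 2)) := by
    rw [hGe]
    refine ContinuousOn.mul continuousOn_const ?_
    refine ContinuousOn.div continuousOn_const (by fun_prop) fun τ hτ => ?_
    exact (Real.sqrt_pos.mpr (by linarith [hτ.1])).ne'
  have hbound : ∀ τ ∈ Set.Icc (0:ℝ) (s / 2), Real.sqrt (∑ q, ‖F τ q‖ ^ 2) ≤ Ge τ := by
    intro τ hτ
    refine (hpt τ hτ.1 hτ.2).trans ?_
    rw [hGe]
    have h1 : 162 / (1 + 81 * Real.exp 1 * (s - τ)) ≤ 162 / (1 + s) :=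
      div_le_div_of_nonneg_left (by norm_num) (by linarith) (by nlinarith [hτ.2])
    have hq : 0 ≤ P / Real.sqrt (1 + τ) := by positivity
    calc 162 / (1 + 81 * Real.exp 1 * (s - τ)) * (P / Real.sqrt (1 + τ))
        ≤ 162 / (1 + s) * (P / Real.sqrt (1 + τ)) := mul_le_mul_of_nonneg_right h1 hq
      _ = 162 / (1 + s) * P * (1 / Real.sqrt (1 + τ)) := by ring
  have hdual := sqrt_sum_norm_sq_le_integral_of_forall_le v F Ge hs4 hFcont hGe_cont hduh hbound
  refine hdual.trans ?_
  rw [hGe, intervalIntegral.integral_const_mul]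
  have hI := integral_inv_sqrt_one_add_le hs4
  have hhalf : Real.sqrt (1 + s / 2) ≤ Real.sqrt (1 + s) := Real.sqrt_le_sqrt (by linarith)
  have hss : Real.sqrt (1 + s) * Real.sqrt (1 + s) = 1 + s := Real.mul_self_sqrt (by linarith)
  calc 162 / (1 + s) * P * ∫ τ in (0:ℝ)..(s / 2), 1 / Real.sqrt (1 + τ)
      ≤ 162 / (1 + s) * P * (2 * Real.sqrt (1 + s / 2)) := mul_le_mul_of_nonneg_left hI (by positivity)
    _ ≤ 162 / (1 + s) * P * (2 * Real.sqrt (1 + s)) := by gcongr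
    _ = 324 * P / Real.sqrt (1 + s) := by
        have hkey : (162 : ℝ) / (1 + s) = 162 / Real.sqrt (1 + s) / Real.sqrt (1 + s) := by
          rw [div_div, hss]
        rw [hkey]
        field_simp
        ring

/-- **Registered form (stub `stub_derivativeColumnAux` of the crux item)**: the Minkowski bookkeeping
`second_vertex_norm_le` at an explicit finite index type (the registered handle under which this helper file lands). -/
theorem stub_derivativeColumnAux :
    ∀ (ι : Type) [Fintype ι] (v : ι → ℂ) (F : ℝ → ι → ℂ) (s P Q : ℝ), 0 ≤ s → 0 ≤ P → 0 ≤ Q →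
      (∀ q, v q = ∫ τ in (0:ℝ)..s, F τ q) → (∀ q, ContinuousOn (fun τ => F τ q) (Set.Icc 0 s)) →
      (∀ τ, 0 ≤ τ → τ ≤ s → Real.sqrt (∑ q, ‖F τ q‖ ^ 2) ≤
        9 * Real.sqrt 2 / Real.sqrt (1 + 162 * Real.exp 1 * (s - τ)) * (P / (1 + τ))) →
      (2 ≤ s → ∀ τ, 0 ≤ τ → τ ≤ s / 2 → Real.sqrt (∑ q, ‖F τ q‖ ^ 2) ≤ Q / (s * Real.sqrt s)) →
      Real.sqrt (∑ q, ‖v q‖ ^ 2) ≤ (80 * P + Q) / Real.sqrt (1 + s) :=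
  fun _ _ v F _ _ _ hs hP hQ hduh hc h1 h2 => second_vertex_norm_le v F hs hP hQ hduh hc h1 h2

end Summit.QuantumFields.QCD.Cruxes.TracedQuadraticParametrix.Sketch

end
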